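import Summits.RiemannHypothesis.RiemannHypothesis.Theorems.EtaLeadingQuarterSecondMomentZerosAssembly
import HarnessLib

/-!
# The second moment of the sharp eta vector at the zeros: reduction to even length
(route EtaLeadingQuarter, item `EtaLeadingSecondMoment`, stmt-RiemannHypothesis-21791)

RH-free bookkeeping. With `V_M(γ) = −1 + ∑_{m=2}^{M} (−1)^m m^{-1/2} m^{iγ}` (the vector of the
statement, `= D_a(−γ)` with `a_k = (−1)^k k^{-1/2}`, tree `Zeros.norm_trialVector_eq`) and
`F(M) = M · ∑'_ρ m(ρ) γ_ρ^{-2} ‖V_M(γ_ρ)‖²`: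

* `norm_dirPoly_succ_le` — `‖D_a^{(M+1)}(t)‖ ≤ ‖D_a^{(M)}(t)‖ + |a_{M+1}|` (one more coefficient);
* `functional_succ_le` — `∑'_ρ m γ^{-2} ‖D^{(M+1)}‖² ≤ (1+θ) ∑'_ρ m γ^{-2} ‖D^{(M)}‖² + (1+1/θ) a_{M+1}² B₀`,
  `B₀ = ∑'_ρ m/γ²` (tree `LittlewoodAverage.summable_zeroOrder_div_im_sq`);
* `etaLeadingSecondMoment_of_even` — if `F(2K) ≤ (1/4 + ε) log(2K)` eventually for every `ε > 0`,
  then `F(M) ≤ (1/4 + ε) log M` eventually for every `ε > 0` (odd `M = 2K+1` costs `(1+2/ε)B₀ = O(1)`).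

So the AFE engine for `T_M(s) = ∑_{m≤M} (−1)^m m^{-s} = 2^{1−s}ζ_K(s) − ζ_{2K}(s)` may stay at even
`M = 2K`. Nothing here bears on the truth of RH.
-/

noncomputable section

open Real Finset Filter Topology Complex

set_option linter.dupNamespace false  -- the mandated namespace repeats `RiemannHypothesis`

namespace Summit.RiemannHypothesis.RiemannHypothesis.Theorems.EtaLeadingQuarter.EtaTrial

open Literature.NumberTheory.LFunctions NicolasJExplicit ZeroSide

/-! ## One more coefficient -/

/-- `a_k² = 1/k` for the eta coefficient `a_k = (−1)^k k^{-1/2}`, `k ≥ 1`. [folklore] -/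
theorem etaCoeff_sq {k : ℕ} (hk : 1 ≤ k) :
    ((-1 : ℝ) ^ k * (k : ℝ) ^ (-(1 / 2 : ℝ))) ^ 2 = 1 / (k : ℝ) := by
  have hk0 : (0 : ℝ) < k := by exact_mod_cast hk
  have h1 : ((-1 : ℝ) ^ k) ^ 2 = 1 := by rw [← pow_mul, mul_comm k 2, pow_mul, neg_one_sq, one_pow]
  have h2 : ((k : ℝ) ^ (-(1 / 2 : ℝ))) ^ 2 = 1 / (k : ℝ) := by
    rw [← Real.rpow_natCast, ← Real.rpow_mul hk0.le,
      show (-(1 / 2 : ℝ)) * ((2 : ℕ) : ℝ) = -1 by norm_num, Real.rpow_neg_one, one_div]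
  rw [mul_pow, h1, h2, one_mul]

/-- The norm of one term `a_k k^{-it}` is `|a_k|` (`k ≥ 1`). [folklore] -/
theorem norm_term_eq (a : ℕ → ℝ) {k : ℕ} (hk : 1 ≤ k) (t : ℝ) :
    ‖((a k : ℝ) : ℂ) * (k : ℂ) ^ (-((t : ℂ) * I))‖ = |a k| := by
  rw [norm_mul, Complex.norm_real, Real.norm_eq_abs, Complex.norm_natCast_cpow_of_pos (by omega)]
  simp

/-- **One more coefficient**: `‖D_a^{(M+1)}(t)‖ ≤ ‖D_a^{(M)}(t)‖ + |a_{M+1}|`. [folklore] -/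
theorem norm_dirPoly_succ_le (a : ℕ → ℝ) (M : ℕ) (t : ℝ) :
    ‖dirPoly a (M + 1) t‖ ≤ ‖dirPoly a M t‖ + |a (M + 1)| := by
  unfold dirPoly
  rw [Finset.sum_Icc_succ_top (by omega), ← norm_term_eq a (k := M + 1) (by omega) t]
  exact norm_add_le _ _

/-! ## The functional at `M + 1` versus `M` -/

/-- **`∑'_ρ m γ^{-2} ‖D^{(M+1)}‖² ≤ (1+θ) ∑'_ρ m γ^{-2} ‖D^{(M)}‖² + (1+1/θ) a_{M+1}² B₀`** for
`θ > 0`, `B₀ = ∑'_ρ m/γ²`. [folklore] -/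
theorem functional_succ_le (a : ℕ → ℝ) (M : ℕ) {θ : ℝ} (hθ : 0 < θ) :
    ∑' ρ : Zeros, (riemannZetaZeroOrder (ρ : ℂ) : ℝ) / (ρ : ℂ).im ^ 2 * ‖dirPoly a (M + 1) (ρ : ℂ).im‖ ^ 2 ≤
      (1 + θ) * ∑' ρ : Zeros, (riemannZetaZeroOrder (ρ : ℂ) : ℝ) / (ρ : ℂ).im ^ 2 * ‖dirPoly a M (ρ : ℂ).im‖ ^ 2 +
      (1 + 1 / θ) * a (M + 1) ^ 2 *
        ∑' ρ : Zeros, (riemannZetaZeroOrder (ρ : ℂ) : ℝ) / (ρ : ℂ).im ^ 2 := by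
  have hs1 := summable_term a M
  have hs0 := LittlewoodAverage.summable_zeroOrder_div_im_sq
  rw [← tsum_mul_left, ← tsum_mul_left, ← (hs1.mul_left _).tsum_add (hs0.mul_left _)]
  refine (summable_term a (M + 1)).tsum_le_tsum (fun ρ ↦ ?_) ((hs1.mul_left _).add (hs0.mul_left _))
  have hw := zeroOrder_div_im_sq_nonneg ρ
  have hpt : ‖dirPoly a (M + 1) (ρ : ℂ).im‖ ^ 2 ≤
      (1 + θ) * ‖dirPoly a M (ρ : ℂ).im‖ ^ 2 + (1 + 1 / θ) * |a (M + 1)| ^ 2 :=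
    (pow_le_pow_left₀ (norm_nonneg _) (norm_dirPoly_succ_le a M _) 2).trans
      (Zeros.add_sq_le_split hθ _ _)
  rw [sq_abs] at hpt
  have := mul_le_mul_of_nonneg_left hpt hw
  linarith

/-! ## Reduction to even `M` -/

/-- The real-arithmetic step of the odd case: with `0 < ε ≤ 1`, `0 ≤ r ≤ ε/16`,
`(2/ε)(1+2/ε)B₀ ≤ L`, `g ≤ (1/4+ε/8)L` and `G ≤ (1+ε/2)(1+r)g + (1+2/ε)B₀`:
`G ≤ (1/4+ε)L`. [folklore] -/
theorem odd_step_numerics {ε L g G B₀ r : ℝ} (hε : 0 < ε) (hε1 : ε ≤ 1) (hr0 : 0 ≤ r)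
    (hr : r ≤ ε / 16) (hB : 0 ≤ B₀) (hL : 2 / ε * ((1 + 2 / ε) * B₀) ≤ L)
    (hg : g ≤ (1 / 4 + ε / 8) * L) (hG : G ≤ (1 + ε / 2) * (1 + r) * g + (1 + 2 / ε) * B₀) :
    G ≤ (1 / 4 + ε) * L := by
  have hL0 : 0 ≤ L := by
    have : 0 ≤ 2 / ε * ((1 + 2 / ε) * B₀) := by positivity
    linarith
  -- the coefficient
  have hc : (1 + ε / 2) * (1 + r) * (1 / 4 + ε / 8) ≤ 1 / 4 + ε / 2 := by
    have h1 : (1 + r) * (1 / 4 + ε / 8) ≤ (1 + ε / 16) * (1 / 4 + ε / 8) :=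
      mul_le_mul_of_nonneg_right (by linarith) (by positivity)
    have h2 : (1 + ε / 2) * ((1 + ε / 16) * (1 / 4 + ε / 8)) ≤ 1 / 4 + ε / 2 := by
      nlinarith [mul_pos hε hε, pow_le_one₀ hε.le hε1 (n := 2), sq_nonneg ε]
    calc (1 + ε / 2) * (1 + r) * (1 / 4 + ε / 8) = (1 + ε / 2) * ((1 + r) * (1 / 4 + ε / 8)) := by ring
      _ ≤ (1 + ε / 2) * ((1 + ε / 16) * (1 / 4 + ε / 8)) := mul_le_mul_of_nonneg_left h1 (by positivity)
      _ ≤ _ := h2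
  -- the constant
  have hB' : (1 + 2 / ε) * B₀ ≤ ε / 2 * L := by
    have e : ε / 2 * (2 / ε * ((1 + 2 / ε) * B₀)) = (1 + 2 / ε) * B₀ := by field_simp
    rw [← e]
    exact mul_le_mul_of_nonneg_left hL (by positivity)
  have hfac : 0 ≤ (1 + ε / 2) * (1 + r) := by positivity
  calc G ≤ (1 + ε / 2) * (1 + r) * g + (1 + 2 / ε) * B₀ := hG
    _ ≤ (1 + ε / 2) * (1 + r) * ((1 / 4 + ε / 8) * L) + ε / 2 * L := by
        gcongr
    _ = ((1 + ε / 2) * (1 + r) * (1 / 4 + ε / 8)) * L + ε / 2 * L := by ring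
    _ ≤ (1 / 4 + ε / 2) * L + ε / 2 * L := by gcongr
    _ = (1 / 4 + ε) * L := by ring

/-- **Even `M` suffice for `EtaLeadingSecondMoment`.** If for every `ε > 0` eventually in `K`
`2K · ∑'_ρ m γ^{-2} ‖V_{2K}(γ)‖² ≤ (1/4 + ε) log(2K)`, then for every `ε > 0` eventually in `M`
`M · ∑'_ρ m γ^{-2} ‖V_M(γ)‖² ≤ (1/4 + ε) log M`. [folklore] -/
theorem etaLeadingSecondMoment_of_even
    (h : ∀ ε : ℝ, 0 < ε → ∀ᶠ K : ℕ in atTop, ((2 * K : ℕ) : ℝ) *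
      (∑' ρ : Zeros, (riemannZetaZeroOrder (ρ : ℂ) : ℝ) / (ρ : ℂ).im ^ 2 *
        ‖-1 + ∑ m ∈ Finset.Icc 2 (2 * K), ((((-1 : ℝ) ^ m * (m : ℝ) ^ (-(1 / 2 : ℝ))) : ℝ) : ℂ) *
          (m : ℂ) ^ ((((ρ : ℂ).im : ℝ) : ℂ) * I)‖ ^ 2) ≤ (1 / 4 + ε) * Real.log ((2 * K : ℕ) : ℝ)) :
    ∀ ε : ℝ, 0 < ε → ∀ᶠ M : ℕ in atTop, (M : ℝ) *
      (∑' ρ : Zeros, (riemannZetaZeroOrder (ρ : ℂ) : ℝ) / (ρ : ℂ).im ^ 2 *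
        ‖-1 + ∑ m ∈ Finset.Icc 2 M, ((((-1 : ℝ) ^ m * (m : ℝ) ^ (-(1 / 2 : ℝ))) : ℝ) : ℂ) *
          (m : ℂ) ^ ((((ρ : ℂ).im : ℝ) : ℂ) * I)‖ ^ 2) ≤ (1 / 4 + ε) * Real.log M := by
  intro ε hε
  classical
  -- `B₀ = ∑'_ρ m/γ² ≥ 0`
  have hB₀0 : 0 ≤ ∑' ρ : Zeros, (riemannZetaZeroOrder (ρ : ℂ) : ℝ) / (ρ : ℂ).im ^ 2 :=
    tsum_nonneg fun ρ ↦ zeroOrder_div_im_sq_nonneg ρ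
  -- the statement's functional in `dirPoly` form
  have hfun : ∀ M : ℕ, 1 ≤ M → ∑' ρ : Zeros, (riemannZetaZeroOrder (ρ : ℂ) : ℝ) / (ρ : ℂ).im ^ 2 *
      ‖-1 + ∑ m ∈ Finset.Icc 2 M, ((((-1 : ℝ) ^ m * (m : ℝ) ^ (-(1 / 2 : ℝ))) : ℝ) : ℂ) *
        (m : ℂ) ^ ((((ρ : ℂ).im : ℝ) : ℂ) * I)‖ ^ 2 =
      ∑' ρ : Zeros, (riemannZetaZeroOrder (ρ : ℂ) : ℝ) / (ρ : ℂ).im ^ 2 *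
        ‖dirPoly (fun k ↦ (-1 : ℝ) ^ k * (k : ℝ) ^ (-(1 / 2 : ℝ))) M (ρ : ℂ).im‖ ^ 2 := by
    intro M hM
    exact tsum_congr fun ρ ↦ by rw [Zeros.norm_trialVector_eq hM]
  -- reduce to `ε ≤ 1`
  set ε₁ : ℝ := min ε 1 with hε₁
  have hε₁0 : 0 < ε₁ := lt_min hε one_pos
  have hε₁1 : ε₁ ≤ 1 := min_le_right _ _
  have hε₁ε : ε₁ ≤ ε := min_le_left _ _
  -- the even case with `ε₁/8`
  obtain ⟨K₀, hK₀⟩ := eventually_atTop.1 (h (ε₁ / 8) (by positivity))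
  -- `log M → ∞` and `M → ∞`
  have hlog : ∀ᶠ M : ℕ in atTop,
      2 / ε₁ * ((1 + 2 / ε₁) * ∑' ρ : Zeros, (riemannZetaZeroOrder (ρ : ℂ) : ℝ) / (ρ : ℂ).im ^ 2) ≤
        Real.log M :=
    (Real.tendsto_log_atTop.comp tendsto_natCast_atTop_atTop).eventually_ge_atTop _
  have hbig : ∀ᶠ M : ℕ in atTop, 16 / ε₁ + 3 ≤ (M : ℝ) := tendsto_natCast_atTop_atTop.eventually_ge_atTop _
  filter_upwards [hlog, hbig, eventually_ge_atTop (2 * K₀ + 2)] with M hlogM hbigM hM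
  have hM1 : 1 ≤ M := by omega
  have hMpos : (0 : ℝ) < M := by exact_mod_cast (show 0 < M by omega)
  have hlogM0 : 0 ≤ Real.log M := Real.log_nonneg (by exact_mod_cast hM1)
  rw [hfun M hM1]
  -- it suffices to prove the bound with `ε₁ ≤ ε`
  suffices hmain : (M : ℝ) * ∑' ρ : Zeros, (riemannZetaZeroOrder (ρ : ℂ) : ℝ) / (ρ : ℂ).im ^ 2 *
      ‖dirPoly (fun k ↦ (-1 : ℝ) ^ k * (k : ℝ) ^ (-(1 / 2 : ℝ))) M (ρ : ℂ).im‖ ^ 2 ≤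
        (1 / 4 + ε₁) * Real.log M from
    hmain.trans (mul_le_mul_of_nonneg_right (by linarith) hlogM0)
  obtain ⟨K, hK⟩ := Nat.even_or_odd' M
  rcases hK with hK | hK
  · -- even `M = 2K`
    have hKK₀ : K₀ ≤ K := by omega
    have h2 := hK₀ K hKK₀
    rw [hfun (2 * K) (by omega), ← hK] at h2
    exact h2.trans (mul_le_mul_of_nonneg_right (by linarith) hlogM0)
  · -- odd `M = 2K + 1`
    have hKK₀ : K₀ ≤ K := by omega
    have hKpos : (0 : ℝ) < K := by exact_mod_cast (show 0 < K by omega)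
    have h2 := hK₀ K hKK₀
    rw [hfun (2 * K) (by omega)] at h2
    have hθ : (0 : ℝ) < ε₁ / 2 := by positivity
    have hsucc := functional_succ_le (fun k ↦ (-1 : ℝ) ^ k * (k : ℝ) ^ (-(1 / 2 : ℝ))) (2 * K) hθ
    rw [etaCoeff_sq (k := 2 * K + 1) (by omega),
      show (1 : ℝ) + 1 / (ε₁ / 2) = 1 + 2 / ε₁ by field_simp] at hsucc
    have hMeq : (M : ℝ) = 2 * K + 1 := by rw [hK]; push_cast; ring
    have h2K : ((2 * K : ℕ) : ℝ) = 2 * K := by push_cast; ring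
    have h2K1 : ((2 * K + 1 : ℕ) : ℝ) = 2 * K + 1 := by push_cast; ring
    rw [h2K] at h2
    rw [h2K1] at hsucc
    -- `log(2K) ≤ log M`
    have hlog2K : Real.log (2 * K) ≤ Real.log M := by
      rw [hMeq]; exact Real.log_le_log (by positivity) (by linarith)
    -- the inputs of `odd_step_numerics`
    have hg : 2 * (K : ℝ) * ∑' ρ : Zeros, (riemannZetaZeroOrder (ρ : ℂ) : ℝ) / (ρ : ℂ).im ^ 2 *
        ‖dirPoly (fun k ↦ (-1 : ℝ) ^ k * (k : ℝ) ^ (-(1 / 2 : ℝ))) (2 * K) (ρ : ℂ).im‖ ^ 2 ≤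
          (1 / 4 + ε₁ / 8) * Real.log M :=
      h2.trans (mul_le_mul_of_nonneg_left hlog2K (by positivity))
    have hr : 1 / (2 * (K : ℝ)) ≤ ε₁ / 16 := by
      rw [div_le_div_iff₀ (by positivity) (by norm_num)]
      have : 16 / ε₁ * ε₁ = 16 := by field_simp
      nlinarith
    have hGM : (M : ℝ) * ∑' ρ : Zeros, (riemannZetaZeroOrder (ρ : ℂ) : ℝ) / (ρ : ℂ).im ^ 2 *
        ‖dirPoly (fun k ↦ (-1 : ℝ) ^ k * (k : ℝ) ^ (-(1 / 2 : ℝ))) M (ρ : ℂ).im‖ ^ 2 ≤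
          (1 + ε₁ / 2) * (1 + 1 / (2 * (K : ℝ))) *
            (2 * (K : ℝ) * ∑' ρ : Zeros, (riemannZetaZeroOrder (ρ : ℂ) : ℝ) / (ρ : ℂ).im ^ 2 *
              ‖dirPoly (fun k ↦ (-1 : ℝ) ^ k * (k : ℝ) ^ (-(1 / 2 : ℝ))) (2 * K) (ρ : ℂ).im‖ ^ 2) +
          (1 + 2 / ε₁) * ∑' ρ : Zeros, (riemannZetaZeroOrder (ρ : ℂ) : ℝ) / (ρ : ℂ).im ^ 2 := by
      have hmul := mul_le_mul_of_nonneg_left hsucc hMpos.le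
      rw [hK] at hmul ⊢
      rw [h2K1] at hmul ⊢
      refine hmul.trans (le_of_eq ?_)
      field_simp
    exact odd_step_numerics hε₁0 hε₁1 (by positivity) hr hB₀0 hlogM hg hGM

end Summit.RiemannHypothesis.RiemannHypothesis.Theorems.EtaLeadingQuarter.EtaTrial

end
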